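import Literature.NumberTheory.Adeles.TwistedFrameLatticeCounts               -- ★ part I (§1 stability lemmas; imports the four engines)
import HarnessLib

/-!
# The lattice counts of a twisted frame, II: the Hecke-neighbour lattices `H(g)` — sandwich, `[H(g) : Λ_a] = [g_{u₀}B : B]`, injectivity
# ([Shimura 1971] §3.2 Lemma 3.22–3.23; [Milne 2005] §6 Thm. 6.11 p. 74 and p. 75; abstract form of (L-c)(L-c′) of the P6 Hecke-roof census)

Topic `NumberTheory/Adeles`; namespace `Literature.NumberTheory.Adeles.Readout`.  THEOREMS ONLY (no definition, no named fact, no instance, no notation,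
no `sorry`).  Cell `hodgecm-mathlib`, half A line L5, X-LEAF socket `stub_EHECKE`, organ (O-L) part 2 = FILE B (DEAL L5-#6, LA5-p02 (g3)), ASSEMBLY layer, part II
(part I = ★ `TwistedFrameLatticeCounts`: `[𝔭⁻¹Λ_a : Λ_a] = q²`, exhaustion): the four generic engines ★ `LatticeIndexLocalReadout` (the index is read locally under density), ★ `AdicCompletionBallLatticeIndex` (`[B(e) : B(e+k)]
= q^{Σk}`), ★ `TorsionModuleStableSubgroupsLineCount` (`q + 1` stable lines, lattice glue) and ★ `TwistedFrameLatticeReadout` ((7a)(7b)(7c) memberships,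
(8) density) are zipped over the ABSTRACT READOUT DATUM of that file — a ring homomorphism `A : M₂(𝔸_{F,f}) →+* M_N(𝔸_{ℚ,f})`, a place `u₀`, its
idempotent `ε`, the local coordinate `θ : 𝔸_{ℚ,f}^N →+ F_{u₀}²` with normal form exponent `m`, and the rational reading `ρ` of `𝓞_F` — into the lattice
statements the E-side Hecke roofs consume (★ `SiegelAdelicMarkingStableLines.exists_stableLines`: `hΛ`, `h𝔞`, `hcard`, `hst`, `hinj`, `hexh`):

* §1 (L-c) `latticeOfGL_map_le_heckeNeighbour`, `heckeNeighbour_le_idealInv`, `relIndex_latticeOfGL_map_heckeNeighbour_eq` — for `g` in a Hecke coset at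
  `u₀` (away-integrality `hg`, local component `g_{u₀}` with `g_{u₀}⁻¹B(m) ⊆ B(m)`, `g_{u₀}B(m) ⊆ B(m−1)`): **`Λ_a ≤ H(g) ≤ 𝔭⁻¹Λ_a` and
  `[H(g) : Λ_a] = [g_{u₀}B(m,m) : B(m,m)]`** (the local index, `= q` for `g_{u₀} ∈ GL₂(𝒪)·diag(ϖ⁻¹,1)·GL₂(𝒪)`).
* §2 (L-c, injectivity) `forall_mem_ball_iff_of_heckeNeighbour_eq` — **`H(g) = H(g′) ⇒ g_{u₀}⁻¹g′_{u₀}` stabilises `B(m,m)`** (hence lies in `GL₂(𝒪_{u₀})`,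
  ★ `forall_valued_mulVec_le_iff_mem_glInt`, hence `gK = g′K`, ★ `mk_eq_mk_iff_evalAt_inv_mul_mem_glInt`).

## References
* [ShimuraIATAF1971] G. Shimura, *Introduction to the Arithmetic Theory of Automorphic Functions* (1971), §3.2 (Lemma 3.22–3.23: the `q + 1` neighbours).
* [Milne2005ShimuraVarieties] J. S. Milne, *Introduction to Shimura varieties* (2005), §4 pp. 48–49, §6 Thm. 6.11 p. 74 and p. 75.
* [PlatonovRapinchuk1994] V. Platonov, A. Rapinchuk, *Algebraic groups and number theory* (1994), §8.1 (a lattice is determined by its localisations).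
* [DiamondShurman2005] F. Diamond, J. Shurman, *A First Course in Modular Forms* (2005), §5.2 (double coset `Γ diag(1,p) Γ`, `p + 1` representatives).

#harness_tags number_theory.adeles, linear_algebra.lattices, number_theory.shimura_varieties
-/

set_option autoImplicit false

noncomputable section

open Matrix NumberField IsDedekindDomain
open Literature.AlgebraicGeometry.ModuliOfAbelianVarieties (finAdeleQ)
open Literature.NumberTheory.Automorphic (integralFiniteAdeles)
open Literature.NumberTheory.Adeles (latticeOfGL mem_latticeOfGL_iff)
open Literature.LinearAlgebra (mem_comap_readout_iff relIndex_comap_readout_eq eq_of_comap_readout_eq)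
open Literature.NumberTheory.LocalFields (exists_addSubgroup_ball relIndex_ball_eq_pow)

namespace Literature.NumberTheory.Adeles.Readout

variable {F : Type} [Field F] [NumberField F] {N : Type} [Fintype N] [DecidableEq N]
  (A : Matrix (Fin 2) (Fin 2) (FiniteAdeleRing (𝓞 F) F) →+* Matrix N N finAdeleQ)
  (u₀ : HeightOneSpectrum (𝓞 F)) (ε : FiniteAdeleRing (𝓞 F) F)
  (θ : (N → finAdeleQ) →+ (Fin 2 → u₀.adicCompletion F)) (m : ℤ)

/-! ### §0 Private carriers (readout map, away class, local preimage) -/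

/-- The reading homomorphism `ι_a : q ↦ A(a⁻¹)·q̂` exists as an additive map. [folklore] -/
private theorem exists_readHom (a : GL (Fin 2) (FiniteAdeleRing (𝓞 F) F)) :
    ∃ ι : (N → ℚ) →+ (N → finAdeleQ), ∀ q : N → ℚ, ι q = A ((a⁻¹ : GL (Fin 2) (FiniteAdeleRing (𝓞 F) F)) : Matrix (Fin 2) (Fin 2) (FiniteAdeleRing (𝓞 F) F)) *ᵥ (⇑(algebraMap ℚ finAdeleQ) ∘ q) := by
  refine ⟨{ toFun := fun q => A ((a⁻¹ : GL (Fin 2) (FiniteAdeleRing (𝓞 F) F)) : Matrix (Fin 2) (Fin 2) (FiniteAdeleRing (𝓞 F) F)) *ᵥ (⇑(algebraMap ℚ finAdeleQ) ∘ q)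
            map_zero' := ?_
            map_add' := fun q q' => ?_ }, fun q => rfl⟩
  · have h : (⇑(algebraMap ℚ finAdeleQ) ∘ (0 : N → ℚ)) = 0 := by
      funext j; simp only [Function.comp_apply, Pi.zero_apply, map_zero]
    rw [h, Matrix.mulVec_zero]
  · have h : (⇑(algebraMap ℚ finAdeleQ) ∘ (q + q')) = (⇑(algebraMap ℚ finAdeleQ) ∘ q) + (⇑(algebraMap ℚ finAdeleQ) ∘ q') := by
      funext j; simp only [Function.comp_apply, Pi.add_apply, map_add]
    rw [h, Matrix.mulVec_add]

/-- The away-integrality class `Away = {z | A(1−ε) z ∈ ẑ^N}` exists as an additive subgroup. [folklore] -/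
private theorem exists_awaySubgroup :
    ∃ W : AddSubgroup (N → finAdeleQ), ∀ z : N → finAdeleQ,
      z ∈ W ↔ ∀ i, (A ((1 - ε) • (1 : Matrix (Fin 2) (Fin 2) (FiniteAdeleRing (𝓞 F) F))) *ᵥ z) i ∈ integralFiniteAdeles ℚ := by
  refine ⟨{ carrier := {z | ∀ i, (A ((1 - ε) • (1 : Matrix (Fin 2) (Fin 2) (FiniteAdeleRing (𝓞 F) F))) *ᵥ z) i ∈ integralFiniteAdeles ℚ}
            add_mem' := fun {z z'} hz hz' i => ?_
            zero_mem' := fun i => by rw [Matrix.mulVec_zero]; exact zero_mem _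
            neg_mem' := fun {z} hz i => by rw [Matrix.mulVec_neg, Pi.neg_apply]; exact neg_mem (hz i) }, fun z => Iff.rfl⟩
  rw [Matrix.mulVec_add, Pi.add_apply]
  exact add_mem (hz i) (hz' i)

/-- The local lattice `L = {ℓ | M ℓ ∈ B}` (a matrix preimage of a subgroup) exists as an additive subgroup. [folklore] -/
private theorem exists_addSubgroup_comap_mulVec (M : Matrix (Fin 2) (Fin 2) (u₀.adicCompletion F))
    (B : AddSubgroup (Fin 2 → u₀.adicCompletion F)) :
    ∃ L : AddSubgroup (Fin 2 → u₀.adicCompletion F), ∀ ℓ, ℓ ∈ L ↔ M *ᵥ ℓ ∈ B :=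
  ⟨B.comap (Matrix.mulVecLin M).toAddMonoidHom, fun _ => Iff.rfl⟩

/-! ### §1 (L-c) The Hecke-neighbour lattice `H(g) = 𝔮⁻¹Λ_{a g} ⊓ 𝔭⁻¹Λ_a`: sandwich and index -/

/-- **`Λ_a ≤ H(g)`**: by (7a) and (7c), since `g_{u₀}⁻¹B(m,m) ⊆ B(m,m)`. [cite: ShimuraIATAF1971, §3.2] [cite: Milne2005ShimuraVarieties, §6 p. 75] -/
theorem latticeOfGL_map_le_heckeNeighbour
    (hsplit : ∀ z : N → finAdeleQ, (∀ i, z i ∈ integralFiniteAdeles ℚ) ↔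
      (∀ i, (A (ε • (1 : Matrix (Fin 2) (Fin 2) (FiniteAdeleRing (𝓞 F) F))) *ᵥ z) i ∈ integralFiniteAdeles ℚ) ∧
      (∀ i, (A ((1 - ε) • (1 : Matrix (Fin 2) (Fin 2) (FiniteAdeleRing (𝓞 F) F))) *ᵥ z) i ∈ integralFiniteAdeles ℚ))
    (hθint : ∀ z : N → finAdeleQ,
      (∀ i, (A (ε • (1 : Matrix (Fin 2) (Fin 2) (FiniteAdeleRing (𝓞 F) F))) *ᵥ z) i ∈ integralFiniteAdeles ℚ) ↔
        ∀ j, Valued.v (θ z j) ≤ WithZero.exp (-m))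
    (hθA : ∀ (X : Matrix (Fin 2) (Fin 2) (FiniteAdeleRing (𝓞 F) F)) (z : N → finAdeleQ),
      θ (A X *ᵥ z) = (X.map fun x : FiniteAdeleRing (𝓞 F) F => x u₀) *ᵥ θ z)
    (haway : ∀ z : N → finAdeleQ,
      (∀ π ∈ u₀.asIdeal, ∀ i, (A (((1 - ε) * algebraMap F (FiniteAdeleRing (𝓞 F) F) ((π : 𝓞 F) : F)) •
        (1 : Matrix (Fin 2) (Fin 2) (FiniteAdeleRing (𝓞 F) F))) *ᵥ z) i ∈ integralFiniteAdeles ℚ) →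
      ∀ i, (A ((1 - ε) • (1 : Matrix (Fin 2) (Fin 2) (FiniteAdeleRing (𝓞 F) F))) *ᵥ z) i ∈ integralFiniteAdeles ℚ)
    (hint : ∀ (b : 𝓞 F) (z : N → finAdeleQ), (∀ i, z i ∈ integralFiniteAdeles ℚ) →
      ∀ i, (A ((algebraMap F (FiniteAdeleRing (𝓞 F) F) ((b : 𝓞 F) : F)) • (1 : Matrix (Fin 2) (Fin 2) (FiniteAdeleRing (𝓞 F) F))) *ᵥ z) i ∈
        integralFiniteAdeles ℚ)
    (ρ : 𝓞 F →+* Matrix N N ℚ)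
    (hρ : ∀ b : 𝓞 F, (ρ b).map (algebraMap ℚ finAdeleQ) =
      A ((algebraMap F (FiniteAdeleRing (𝓞 F) F) ((b : 𝓞 F) : F)) • (1 : Matrix (Fin 2) (Fin 2) (FiniteAdeleRing (𝓞 F) F))))
    (𝔮 : Ideal (𝓞 F)) (π₁ : 𝓞 F) (hπ₁ : π₁ ∈ 𝔮) (hπ₁v : Valued.v ((algebraMap F (FiniteAdeleRing (𝓞 F) F) (π₁ : F)) u₀) = 1)
    (a g : GL (Fin 2) (FiniteAdeleRing (𝓞 F) F))
    (hg : ∀ π ∈ 𝔮, ∀ y : N → finAdeleQ,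
      (∀ i, (A ((1 - ε) • (1 : Matrix (Fin 2) (Fin 2) (FiniteAdeleRing (𝓞 F) F))) *ᵥ y) i ∈ integralFiniteAdeles ℚ) →
      ∀ i, (A ((1 - ε) • ((algebraMap F (FiniteAdeleRing (𝓞 F) F) ((π : 𝓞 F) : F)) •
        ((g⁻¹ : GL (Fin 2) (FiniteAdeleRing (𝓞 F) F)) : Matrix (Fin 2) (Fin 2) (FiniteAdeleRing (𝓞 F) F)))) *ᵥ y) i ∈ integralFiniteAdeles ℚ)
    (gu : GL (Fin 2) (u₀.adicCompletion F))
    (hgu : (((g : GL (Fin 2) (FiniteAdeleRing (𝓞 F) F)) : Matrix (Fin 2) (Fin 2) (FiniteAdeleRing (𝓞 F) F)).map fun x : FiniteAdeleRing (𝓞 F) F => x u₀) =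
      ((gu : GL (Fin 2) (u₀.adicCompletion F)) : Matrix (Fin 2) (Fin 2) (u₀.adicCompletion F)))
    (hgui : (((g⁻¹ : GL (Fin 2) (FiniteAdeleRing (𝓞 F) F)) : Matrix (Fin 2) (Fin 2) (FiniteAdeleRing (𝓞 F) F)).map fun x : FiniteAdeleRing (𝓞 F) F => x u₀) =
      ((gu⁻¹ : GL (Fin 2) (u₀.adicCompletion F)) : Matrix (Fin 2) (Fin 2) (u₀.adicCompletion F)))
    (hguB : ∀ ℓ : Fin 2 → u₀.adicCompletion F, (∀ j, Valued.v (ℓ j) ≤ WithZero.exp (-m)) →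
      ∀ j, Valued.v (((((gu⁻¹ : GL (Fin 2) (u₀.adicCompletion F)) : Matrix (Fin 2) (Fin 2) (u₀.adicCompletion F))) *ᵥ ℓ) j) ≤
        WithZero.exp (-m))
    (hguB' : ∀ ℓ : Fin 2 → u₀.adicCompletion F, (∀ j, Valued.v (ℓ j) ≤ WithZero.exp (-m)) →
      ∀ j, Valued.v (((((gu : GL (Fin 2) (u₀.adicCompletion F)) : Matrix (Fin 2) (Fin 2) (u₀.adicCompletion F))) *ᵥ ℓ) j) ≤
        WithZero.exp (-(m - 1)))
    (H : Submodule ℤ (N → ℚ))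
    (hH : ∀ q : N → ℚ, q ∈ H ↔ (∀ π ∈ 𝔮, ρ π *ᵥ q ∈ latticeOfGL (Units.map (A : Matrix (Fin 2) (Fin 2) (FiniteAdeleRing (𝓞 F) F) →* Matrix N N finAdeleQ) (a * g))) ∧
      ∀ π ∈ u₀.asIdeal, ρ π *ᵥ q ∈ latticeOfGL (Units.map (A : Matrix (Fin 2) (Fin 2) (FiniteAdeleRing (𝓞 F) F) →* Matrix N N finAdeleQ) a)) :
    latticeOfGL (Units.map (A : Matrix (Fin 2) (Fin 2) (FiniteAdeleRing (𝓞 F) F) →* Matrix N N finAdeleQ) a) ≤ H := by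
  intro q hq
  have hgloc : ∀ ℓ : Fin 2 → u₀.adicCompletion F, (∀ j, Valued.v (ℓ j) ≤ WithZero.exp (-m)) →
      ∀ j, Valued.v (((((g : GL (Fin 2) (FiniteAdeleRing (𝓞 F) F)) : Matrix (Fin 2) (Fin 2) (FiniteAdeleRing (𝓞 F) F)).map fun x : FiniteAdeleRing (𝓞 F) F => x u₀) *ᵥ ℓ) j) ≤ WithZero.exp (-(m - 1)) := by
    rw [hgu]; exact hguB'
  rw [hH, forall_mulVec_mem_latticeOfGL_map_mul_iff_readout A u₀ ε θ m hsplit hθint hθA haway hint ρ hρ 𝔮 π₁ hπ₁ hπ₁v a g hg hgloc q, hgui]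
  have h := (mem_latticeOfGL_map_iff_readout A u₀ ε θ m hsplit hθint a q).1 hq
  exact ⟨h.1, hguB _ h.2⟩

/-- **`H(g) ≤ 𝔭_{u₀}⁻¹Λ_a`** (the second conjunct of the membership). [cite: ShimuraIATAF1971, §3.2] -/
theorem heckeNeighbour_le_idealInv (ρ : 𝓞 F →+* Matrix N N ℚ) (𝔮 : Ideal (𝓞 F)) (a g : GL (Fin 2) (FiniteAdeleRing (𝓞 F) F))
    (H : Submodule ℤ (N → ℚ))
    (hH : ∀ q : N → ℚ, q ∈ H ↔ (∀ π ∈ 𝔮, ρ π *ᵥ q ∈ latticeOfGL (Units.map (A : Matrix (Fin 2) (Fin 2) (FiniteAdeleRing (𝓞 F) F) →* Matrix N N finAdeleQ) (a * g))) ∧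
      ∀ π ∈ u₀.asIdeal, ρ π *ᵥ q ∈ latticeOfGL (Units.map (A : Matrix (Fin 2) (Fin 2) (FiniteAdeleRing (𝓞 F) F) →* Matrix N N finAdeleQ) a))
    (L' : Submodule ℤ (N → ℚ)) (hL' : ∀ q : N → ℚ, q ∈ L' ↔ ∀ π ∈ u₀.asIdeal, ρ π *ᵥ q ∈ latticeOfGL (Units.map (A : Matrix (Fin 2) (Fin 2) (FiniteAdeleRing (𝓞 F) F) →* Matrix N N finAdeleQ) a)) :
    H ≤ L' :=
  fun q hq => (hL' q).2 ((hH q).1 hq).2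

/-- **`H(g)` is `ρ(𝓞_F)`-stable.** [cite: ShimuraIATAF1971, §3.2] -/
theorem mulVec_mem_heckeNeighbour
    (hint : ∀ (b : 𝓞 F) (z : N → finAdeleQ), (∀ i, z i ∈ integralFiniteAdeles ℚ) →
      ∀ i, (A ((algebraMap F (FiniteAdeleRing (𝓞 F) F) ((b : 𝓞 F) : F)) • (1 : Matrix (Fin 2) (Fin 2) (FiniteAdeleRing (𝓞 F) F))) *ᵥ z) i ∈
        integralFiniteAdeles ℚ)
    (ρ : 𝓞 F →+* Matrix N N ℚ)
    (hρ : ∀ b : 𝓞 F, (ρ b).map (algebraMap ℚ finAdeleQ) =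
      A ((algebraMap F (FiniteAdeleRing (𝓞 F) F) ((b : 𝓞 F) : F)) • (1 : Matrix (Fin 2) (Fin 2) (FiniteAdeleRing (𝓞 F) F))))
    (𝔮 : Ideal (𝓞 F)) (a g : GL (Fin 2) (FiniteAdeleRing (𝓞 F) F))
    (H : Submodule ℤ (N → ℚ))
    (hH : ∀ q : N → ℚ, q ∈ H ↔ (∀ π ∈ 𝔮, ρ π *ᵥ q ∈ latticeOfGL (Units.map (A : Matrix (Fin 2) (Fin 2) (FiniteAdeleRing (𝓞 F) F) →* Matrix N N finAdeleQ) (a * g))) ∧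
      ∀ π ∈ u₀.asIdeal, ρ π *ᵥ q ∈ latticeOfGL (Units.map (A : Matrix (Fin 2) (Fin 2) (FiniteAdeleRing (𝓞 F) F) →* Matrix N N finAdeleQ) a))
    (b : 𝓞 F) {q : N → ℚ} (hq : q ∈ H) : ρ b *ᵥ q ∈ H :=
  (hH _).2 (mulVec_mem_of_forall_mulVec_mem A hint ρ hρ (a * g) a (𝔮 : Set (𝓞 F)) (u₀.asIdeal : Set (𝓞 F)) b ((hH q).1 hq))

/-- **(L-c) `[H(g) : Λ_a] = [g_{u₀}B(m,m) : B(m,m)]`.**  `Λ_a = ι⁻¹(Away ⊓ θ⁻¹B)` (7a) and `H(g) = ι⁻¹(Away ⊓ θ⁻¹(g_{u₀}B))` (7c) with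
`B ≤ g_{u₀}B ≤ B(m−1,m−1)`; density (8) at depth `1` makes the index local (★ `relIndex_comap_readout_eq`).  For `g_{u₀} ∈ GL₂(𝒪)·diag(ϖ⁻¹,1)·GL₂(𝒪)`
the right-hand side is `q`. [cite: ShimuraIATAF1971, §3.2 Lemma 3.22–3.23] [cite: Milne2005ShimuraVarieties, §6 Thm. 6.11 p. 74 and p. 75]
[cite: PlatonovRapinchuk1994, §8.1] -/
theorem relIndex_latticeOfGL_map_heckeNeighbour_eq
    (hsplit : ∀ z : N → finAdeleQ, (∀ i, z i ∈ integralFiniteAdeles ℚ) ↔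
      (∀ i, (A (ε • (1 : Matrix (Fin 2) (Fin 2) (FiniteAdeleRing (𝓞 F) F))) *ᵥ z) i ∈ integralFiniteAdeles ℚ) ∧
      (∀ i, (A ((1 - ε) • (1 : Matrix (Fin 2) (Fin 2) (FiniteAdeleRing (𝓞 F) F))) *ᵥ z) i ∈ integralFiniteAdeles ℚ))
    (hθint : ∀ z : N → finAdeleQ,
      (∀ i, (A (ε • (1 : Matrix (Fin 2) (Fin 2) (FiniteAdeleRing (𝓞 F) F))) *ᵥ z) i ∈ integralFiniteAdeles ℚ) ↔
        ∀ j, Valued.v (θ z j) ≤ WithZero.exp (-m))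
    (hθA : ∀ (X : Matrix (Fin 2) (Fin 2) (FiniteAdeleRing (𝓞 F) F)) (z : N → finAdeleQ),
      θ (A X *ᵥ z) = (X.map fun x : FiniteAdeleRing (𝓞 F) F => x u₀) *ᵥ θ z)
    (haway : ∀ z : N → finAdeleQ,
      (∀ π ∈ u₀.asIdeal, ∀ i, (A (((1 - ε) * algebraMap F (FiniteAdeleRing (𝓞 F) F) ((π : 𝓞 F) : F)) •
        (1 : Matrix (Fin 2) (Fin 2) (FiniteAdeleRing (𝓞 F) F))) *ᵥ z) i ∈ integralFiniteAdeles ℚ) →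
      ∀ i, (A ((1 - ε) • (1 : Matrix (Fin 2) (Fin 2) (FiniteAdeleRing (𝓞 F) F))) *ᵥ z) i ∈ integralFiniteAdeles ℚ)
    (hint : ∀ (b : 𝓞 F) (z : N → finAdeleQ), (∀ i, z i ∈ integralFiniteAdeles ℚ) →
      ∀ i, (A ((algebraMap F (FiniteAdeleRing (𝓞 F) F) ((b : 𝓞 F) : F)) • (1 : Matrix (Fin 2) (Fin 2) (FiniteAdeleRing (𝓞 F) F))) *ᵥ z) i ∈
        integralFiniteAdeles ℚ)
    (ρ : 𝓞 F →+* Matrix N N ℚ)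
    (hρ : ∀ b : 𝓞 F, (ρ b).map (algebraMap ℚ finAdeleQ) =
      A ((algebraMap F (FiniteAdeleRing (𝓞 F) F) ((b : 𝓞 F) : F)) • (1 : Matrix (Fin 2) (Fin 2) (FiniteAdeleRing (𝓞 F) F))))
    (hθsurj : Function.Surjective θ) (hε : ε * ε = ε) (hε₁ : ε u₀ = 1)
    {p : ℕ} (hp : p ≠ 0) (hpu : ((p : 𝓞 F)) ∈ u₀.asIdeal)
    (𝔮 : Ideal (𝓞 F)) (π₁ : 𝓞 F) (hπ₁ : π₁ ∈ 𝔮) (hπ₁v : Valued.v ((algebraMap F (FiniteAdeleRing (𝓞 F) F) (π₁ : F)) u₀) = 1)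
    (a g : GL (Fin 2) (FiniteAdeleRing (𝓞 F) F))
    (hg : ∀ π ∈ 𝔮, ∀ y : N → finAdeleQ,
      (∀ i, (A ((1 - ε) • (1 : Matrix (Fin 2) (Fin 2) (FiniteAdeleRing (𝓞 F) F))) *ᵥ y) i ∈ integralFiniteAdeles ℚ) →
      ∀ i, (A ((1 - ε) • ((algebraMap F (FiniteAdeleRing (𝓞 F) F) ((π : 𝓞 F) : F)) •
        ((g⁻¹ : GL (Fin 2) (FiniteAdeleRing (𝓞 F) F)) : Matrix (Fin 2) (Fin 2) (FiniteAdeleRing (𝓞 F) F)))) *ᵥ y) i ∈ integralFiniteAdeles ℚ)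
    (gu : GL (Fin 2) (u₀.adicCompletion F))
    (hgu : (((g : GL (Fin 2) (FiniteAdeleRing (𝓞 F) F)) : Matrix (Fin 2) (Fin 2) (FiniteAdeleRing (𝓞 F) F)).map fun x : FiniteAdeleRing (𝓞 F) F => x u₀) =
      ((gu : GL (Fin 2) (u₀.adicCompletion F)) : Matrix (Fin 2) (Fin 2) (u₀.adicCompletion F)))
    (hgui : (((g⁻¹ : GL (Fin 2) (FiniteAdeleRing (𝓞 F) F)) : Matrix (Fin 2) (Fin 2) (FiniteAdeleRing (𝓞 F) F)).map fun x : FiniteAdeleRing (𝓞 F) F => x u₀) =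
      ((gu⁻¹ : GL (Fin 2) (u₀.adicCompletion F)) : Matrix (Fin 2) (Fin 2) (u₀.adicCompletion F)))
    (hguB : ∀ ℓ : Fin 2 → u₀.adicCompletion F, (∀ j, Valued.v (ℓ j) ≤ WithZero.exp (-m)) →
      ∀ j, Valued.v (((((gu⁻¹ : GL (Fin 2) (u₀.adicCompletion F)) : Matrix (Fin 2) (Fin 2) (u₀.adicCompletion F))) *ᵥ ℓ) j) ≤
        WithZero.exp (-m))
    (hguB' : ∀ ℓ : Fin 2 → u₀.adicCompletion F, (∀ j, Valued.v (ℓ j) ≤ WithZero.exp (-m)) →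
      ∀ j, Valued.v (((((gu : GL (Fin 2) (u₀.adicCompletion F)) : Matrix (Fin 2) (Fin 2) (u₀.adicCompletion F))) *ᵥ ℓ) j) ≤
        WithZero.exp (-(m - 1)))
    (B L : AddSubgroup (Fin 2 → u₀.adicCompletion F)) (hB : ∀ ℓ, ℓ ∈ B ↔ ∀ j, Valued.v (ℓ j) ≤ WithZero.exp (-m))
    (hL : ∀ ℓ, ℓ ∈ L ↔ ∀ j, Valued.v ((((gu⁻¹ : GL (Fin 2) (u₀.adicCompletion F)) : Matrix (Fin 2) (Fin 2) (u₀.adicCompletion F)) *ᵥ ℓ) j) ≤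
      WithZero.exp (-m))
    (H : Submodule ℤ (N → ℚ))
    (hH : ∀ q : N → ℚ, q ∈ H ↔ (∀ π ∈ 𝔮, ρ π *ᵥ q ∈ latticeOfGL (Units.map (A : Matrix (Fin 2) (Fin 2) (FiniteAdeleRing (𝓞 F) F) →* Matrix N N finAdeleQ) (a * g))) ∧
      ∀ π ∈ u₀.asIdeal, ρ π *ᵥ q ∈ latticeOfGL (Units.map (A : Matrix (Fin 2) (Fin 2) (FiniteAdeleRing (𝓞 F) F) →* Matrix N N finAdeleQ) a)) :
    (latticeOfGL (Units.map (A : Matrix (Fin 2) (Fin 2) (FiniteAdeleRing (𝓞 F) F) →* Matrix N N finAdeleQ) a)).toAddSubgroup.relIndex H.toAddSubgroup = B.relIndex L := by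
  obtain ⟨ι, hι⟩ := exists_readHom A a
  obtain ⟨W, hW⟩ := exists_awaySubgroup A ε
  have hgloc : ∀ ℓ : Fin 2 → u₀.adicCompletion F, (∀ j, Valued.v (ℓ j) ≤ WithZero.exp (-m)) →
      ∀ j, Valued.v (((((g : GL (Fin 2) (FiniteAdeleRing (𝓞 F) F)) : Matrix (Fin 2) (Fin 2) (FiniteAdeleRing (𝓞 F) F)).map fun x : FiniteAdeleRing (𝓞 F) F => x u₀) *ᵥ ℓ) j) ≤ WithZero.exp (-(m - 1)) := by
    rw [hgu]; exact hguB'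
  have hΛ : (latticeOfGL (Units.map (A : Matrix (Fin 2) (Fin 2) (FiniteAdeleRing (𝓞 F) F) →* Matrix N N finAdeleQ) a)).toAddSubgroup = (W ⊓ B.comap θ).comap ι := by
    ext q
    rw [Submodule.mem_toAddSubgroup, mem_comap_readout_iff, hW, hB, hι, mem_latticeOfGL_map_iff_readout A u₀ ε θ m hsplit hθint a q]
  have hHr : H.toAddSubgroup = (W ⊓ L.comap θ).comap ι := by
    ext q
    rw [Submodule.mem_toAddSubgroup, hH, mem_comap_readout_iff, hW, hL, hι,
      forall_mulVec_mem_latticeOfGL_map_mul_iff_readout A u₀ ε θ m hsplit hθint hθA haway hint ρ hρ 𝔮 π₁ hπ₁ hπ₁v a g hg hgloc q, hgui]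
  -- `B ≤ L ≤ B(m-1,m-1)`
  have hBL : B ≤ L := fun ℓ hℓ => (hL ℓ).2 (hguB ℓ ((hB ℓ).1 hℓ))
  have hLB : ∀ e ∈ L, ∀ j, Valued.v (e j) ≤ WithZero.exp (-(m - 1)) := by
    intro e he
    have h1 : ((gu : GL (Fin 2) (u₀.adicCompletion F)) : Matrix (Fin 2) (Fin 2) (u₀.adicCompletion F)) *ᵥ
        ((((gu⁻¹ : GL (Fin 2) (u₀.adicCompletion F)) : Matrix (Fin 2) (Fin 2) (u₀.adicCompletion F))) *ᵥ e) = e := by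
      rw [Matrix.mulVec_mulVec, ← Units.val_mul, mul_inv_cancel, Units.val_one, Matrix.one_mulVec]
    rw [← h1]
    exact hguB' _ ((hL e).1 he)
  have hdense : ∀ e ∈ L, ∃ v : N → ℚ, ι v ∈ W ∧ θ (ι v) - e ∈ B := by
    intro e he
    obtain ⟨q, hqA, hq⟩ := exists_rat_readout_sub_mem A u₀ ε θ m hsplit hθint hθA hθsurj hε hε₁ hp hpu a 1 e
      (fun j => by rw [Nat.cast_one]; exact hLB e he j)
    exact ⟨q, (hW _).2 (by rw [hι]; exact hqA), (hB _).2 (by rw [hι]; exact hq)⟩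
  rw [hΛ, hHr, relIndex_comap_readout_eq ι θ W hBL hdense]

/-! ### §2 (L-c) Injectivity: `H(g) = H(g′)` forces `g_{u₀}⁻¹ g′_{u₀}` to stabilise `B(m,m)` -/

/-- **INJECTIVITY OF `gK ↦ H(g)` (local form).**  If `H(g) = H(g′)` then the local lattices `g_{u₀}B(m,m)` and `g′_{u₀}B(m,m)` coincide (★
`eq_of_comap_readout_eq` with `M = B(m,m)`, density (8)), i.e. `g_{u₀}⁻¹g′_{u₀}` stabilises `B(m,m)` — so it lies in `GL₂(𝒪_{u₀})` and `gK = g′K` for a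
level `K` detected at `u₀`. [cite: ShimuraIATAF1971, §3.2] [cite: Milne2005ShimuraVarieties, §6 Thm. 6.11 p. 74 and p. 75] [cite: PlatonovRapinchuk1994, §8.1] -/
theorem forall_mem_ball_iff_of_heckeNeighbour_eq
    (hsplit : ∀ z : N → finAdeleQ, (∀ i, z i ∈ integralFiniteAdeles ℚ) ↔
      (∀ i, (A (ε • (1 : Matrix (Fin 2) (Fin 2) (FiniteAdeleRing (𝓞 F) F))) *ᵥ z) i ∈ integralFiniteAdeles ℚ) ∧
      (∀ i, (A ((1 - ε) • (1 : Matrix (Fin 2) (Fin 2) (FiniteAdeleRing (𝓞 F) F))) *ᵥ z) i ∈ integralFiniteAdeles ℚ))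
    (hθint : ∀ z : N → finAdeleQ,
      (∀ i, (A (ε • (1 : Matrix (Fin 2) (Fin 2) (FiniteAdeleRing (𝓞 F) F))) *ᵥ z) i ∈ integralFiniteAdeles ℚ) ↔
        ∀ j, Valued.v (θ z j) ≤ WithZero.exp (-m))
    (hθA : ∀ (X : Matrix (Fin 2) (Fin 2) (FiniteAdeleRing (𝓞 F) F)) (z : N → finAdeleQ),
      θ (A X *ᵥ z) = (X.map fun x : FiniteAdeleRing (𝓞 F) F => x u₀) *ᵥ θ z)
    (haway : ∀ z : N → finAdeleQ,
      (∀ π ∈ u₀.asIdeal, ∀ i, (A (((1 - ε) * algebraMap F (FiniteAdeleRing (𝓞 F) F) ((π : 𝓞 F) : F)) •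
        (1 : Matrix (Fin 2) (Fin 2) (FiniteAdeleRing (𝓞 F) F))) *ᵥ z) i ∈ integralFiniteAdeles ℚ) →
      ∀ i, (A ((1 - ε) • (1 : Matrix (Fin 2) (Fin 2) (FiniteAdeleRing (𝓞 F) F))) *ᵥ z) i ∈ integralFiniteAdeles ℚ)
    (hint : ∀ (b : 𝓞 F) (z : N → finAdeleQ), (∀ i, z i ∈ integralFiniteAdeles ℚ) →
      ∀ i, (A ((algebraMap F (FiniteAdeleRing (𝓞 F) F) ((b : 𝓞 F) : F)) • (1 : Matrix (Fin 2) (Fin 2) (FiniteAdeleRing (𝓞 F) F))) *ᵥ z) i ∈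
        integralFiniteAdeles ℚ)
    (ρ : 𝓞 F →+* Matrix N N ℚ)
    (hρ : ∀ b : 𝓞 F, (ρ b).map (algebraMap ℚ finAdeleQ) =
      A ((algebraMap F (FiniteAdeleRing (𝓞 F) F) ((b : 𝓞 F) : F)) • (1 : Matrix (Fin 2) (Fin 2) (FiniteAdeleRing (𝓞 F) F))))
    (hθsurj : Function.Surjective θ) (hε : ε * ε = ε) (hε₁ : ε u₀ = 1)
    {p : ℕ} (hp : p ≠ 0) (hpu : ((p : 𝓞 F)) ∈ u₀.asIdeal)
    (𝔮 : Ideal (𝓞 F)) (π₁ : 𝓞 F) (hπ₁ : π₁ ∈ 𝔮) (hπ₁v : Valued.v ((algebraMap F (FiniteAdeleRing (𝓞 F) F) (π₁ : F)) u₀) = 1)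
    (a g g' : GL (Fin 2) (FiniteAdeleRing (𝓞 F) F))
    (hg : ∀ π ∈ 𝔮, ∀ y : N → finAdeleQ,
      (∀ i, (A ((1 - ε) • (1 : Matrix (Fin 2) (Fin 2) (FiniteAdeleRing (𝓞 F) F))) *ᵥ y) i ∈ integralFiniteAdeles ℚ) →
      ∀ i, (A ((1 - ε) • ((algebraMap F (FiniteAdeleRing (𝓞 F) F) ((π : 𝓞 F) : F)) •
        ((g⁻¹ : GL (Fin 2) (FiniteAdeleRing (𝓞 F) F)) : Matrix (Fin 2) (Fin 2) (FiniteAdeleRing (𝓞 F) F)))) *ᵥ y) i ∈ integralFiniteAdeles ℚ)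
    (hg' : ∀ π ∈ 𝔮, ∀ y : N → finAdeleQ,
      (∀ i, (A ((1 - ε) • (1 : Matrix (Fin 2) (Fin 2) (FiniteAdeleRing (𝓞 F) F))) *ᵥ y) i ∈ integralFiniteAdeles ℚ) →
      ∀ i, (A ((1 - ε) • ((algebraMap F (FiniteAdeleRing (𝓞 F) F) ((π : 𝓞 F) : F)) •
        ((g'⁻¹ : GL (Fin 2) (FiniteAdeleRing (𝓞 F) F)) : Matrix (Fin 2) (Fin 2) (FiniteAdeleRing (𝓞 F) F)))) *ᵥ y) i ∈ integralFiniteAdeles ℚ)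
    (gu : GL (Fin 2) (u₀.adicCompletion F))
    (hgu : (((g : GL (Fin 2) (FiniteAdeleRing (𝓞 F) F)) : Matrix (Fin 2) (Fin 2) (FiniteAdeleRing (𝓞 F) F)).map fun x : FiniteAdeleRing (𝓞 F) F => x u₀) =
      ((gu : GL (Fin 2) (u₀.adicCompletion F)) : Matrix (Fin 2) (Fin 2) (u₀.adicCompletion F)))
    (hgui : (((g⁻¹ : GL (Fin 2) (FiniteAdeleRing (𝓞 F) F)) : Matrix (Fin 2) (Fin 2) (FiniteAdeleRing (𝓞 F) F)).map fun x : FiniteAdeleRing (𝓞 F) F => x u₀) =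
      ((gu⁻¹ : GL (Fin 2) (u₀.adicCompletion F)) : Matrix (Fin 2) (Fin 2) (u₀.adicCompletion F)))
    (hguB : ∀ ℓ : Fin 2 → u₀.adicCompletion F, (∀ j, Valued.v (ℓ j) ≤ WithZero.exp (-m)) →
      ∀ j, Valued.v (((((gu⁻¹ : GL (Fin 2) (u₀.adicCompletion F)) : Matrix (Fin 2) (Fin 2) (u₀.adicCompletion F))) *ᵥ ℓ) j) ≤
        WithZero.exp (-m))
    (hguB' : ∀ ℓ : Fin 2 → u₀.adicCompletion F, (∀ j, Valued.v (ℓ j) ≤ WithZero.exp (-m)) →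
      ∀ j, Valued.v (((((gu : GL (Fin 2) (u₀.adicCompletion F)) : Matrix (Fin 2) (Fin 2) (u₀.adicCompletion F))) *ᵥ ℓ) j) ≤
        WithZero.exp (-(m - 1)))
    (gu' : GL (Fin 2) (u₀.adicCompletion F))
    (hgu' : (((g' : GL (Fin 2) (FiniteAdeleRing (𝓞 F) F)) : Matrix (Fin 2) (Fin 2) (FiniteAdeleRing (𝓞 F) F)).map fun x : FiniteAdeleRing (𝓞 F) F => x u₀) =
      ((gu' : GL (Fin 2) (u₀.adicCompletion F)) : Matrix (Fin 2) (Fin 2) (u₀.adicCompletion F)))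
    (hgu'i : (((g'⁻¹ : GL (Fin 2) (FiniteAdeleRing (𝓞 F) F)) : Matrix (Fin 2) (Fin 2) (FiniteAdeleRing (𝓞 F) F)).map fun x : FiniteAdeleRing (𝓞 F) F => x u₀) =
      ((gu'⁻¹ : GL (Fin 2) (u₀.adicCompletion F)) : Matrix (Fin 2) (Fin 2) (u₀.adicCompletion F)))
    (hgu'B : ∀ ℓ : Fin 2 → u₀.adicCompletion F, (∀ j, Valued.v (ℓ j) ≤ WithZero.exp (-m)) →
      ∀ j, Valued.v (((((gu'⁻¹ : GL (Fin 2) (u₀.adicCompletion F)) : Matrix (Fin 2) (Fin 2) (u₀.adicCompletion F))) *ᵥ ℓ) j) ≤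
        WithZero.exp (-m))
    (hgu'B' : ∀ ℓ : Fin 2 → u₀.adicCompletion F, (∀ j, Valued.v (ℓ j) ≤ WithZero.exp (-m)) →
      ∀ j, Valued.v (((((gu' : GL (Fin 2) (u₀.adicCompletion F)) : Matrix (Fin 2) (Fin 2) (u₀.adicCompletion F))) *ᵥ ℓ) j) ≤
        WithZero.exp (-(m - 1)))
    (H : Submodule ℤ (N → ℚ))
    (hH : ∀ q : N → ℚ, q ∈ H ↔ (∀ π ∈ 𝔮, ρ π *ᵥ q ∈ latticeOfGL (Units.map (A : Matrix (Fin 2) (Fin 2) (FiniteAdeleRing (𝓞 F) F) →* Matrix N N finAdeleQ) (a * g))) ∧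
      ∀ π ∈ u₀.asIdeal, ρ π *ᵥ q ∈ latticeOfGL (Units.map (A : Matrix (Fin 2) (Fin 2) (FiniteAdeleRing (𝓞 F) F) →* Matrix N N finAdeleQ) a))
    (H' : Submodule ℤ (N → ℚ))
    (hH' : ∀ q : N → ℚ, q ∈ H' ↔ (∀ π ∈ 𝔮, ρ π *ᵥ q ∈ latticeOfGL (Units.map (A : Matrix (Fin 2) (Fin 2) (FiniteAdeleRing (𝓞 F) F) →* Matrix N N finAdeleQ) (a * g'))) ∧
      ∀ π ∈ u₀.asIdeal, ρ π *ᵥ q ∈ latticeOfGL (Units.map (A : Matrix (Fin 2) (Fin 2) (FiniteAdeleRing (𝓞 F) F) →* Matrix N N finAdeleQ) a))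
    (hHH' : H = H') (ℓ : Fin 2 → u₀.adicCompletion F) :
    (∀ j, Valued.v (ℓ j) ≤ WithZero.exp (-m)) ↔
      ∀ j, Valued.v (((((gu⁻¹ * gu' : GL (Fin 2) (u₀.adicCompletion F))) : Matrix (Fin 2) (Fin 2) (u₀.adicCompletion F)) *ᵥ ℓ) j) ≤
        WithZero.exp (-m) := by
  obtain ⟨ι, hι⟩ := exists_readHom A a
  obtain ⟨W, hW⟩ := exists_awaySubgroup A ε
  obtain ⟨B, hB₀⟩ := exists_addSubgroup_ball F u₀ (fun _ : Fin 2 => m)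
  have hB : ∀ ℓ, ℓ ∈ B ↔ ∀ j, Valued.v (ℓ j) ≤ WithZero.exp (-m) := hB₀
  obtain ⟨L, hL⟩ := exists_addSubgroup_comap_mulVec u₀
    (((gu⁻¹ : GL (Fin 2) (u₀.adicCompletion F)) : Matrix (Fin 2) (Fin 2) (u₀.adicCompletion F))) B
  obtain ⟨L', hL'⟩ := exists_addSubgroup_comap_mulVec u₀
    (((gu'⁻¹ : GL (Fin 2) (u₀.adicCompletion F)) : Matrix (Fin 2) (Fin 2) (u₀.adicCompletion F))) B
  have hgloc : ∀ ℓ : Fin 2 → u₀.adicCompletion F, (∀ j, Valued.v (ℓ j) ≤ WithZero.exp (-m)) →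
      ∀ j, Valued.v (((((g : GL (Fin 2) (FiniteAdeleRing (𝓞 F) F)) : Matrix (Fin 2) (Fin 2) (FiniteAdeleRing (𝓞 F) F)).map fun x : FiniteAdeleRing (𝓞 F) F => x u₀) *ᵥ ℓ) j) ≤ WithZero.exp (-(m - 1)) := by
    rw [hgu]; exact hguB'
  have hgloc' : ∀ ℓ : Fin 2 → u₀.adicCompletion F, (∀ j, Valued.v (ℓ j) ≤ WithZero.exp (-m)) →
      ∀ j, Valued.v (((((g' : GL (Fin 2) (FiniteAdeleRing (𝓞 F) F)) : Matrix (Fin 2) (Fin 2) (FiniteAdeleRing (𝓞 F) F)).map fun x : FiniteAdeleRing (𝓞 F) F => x u₀) *ᵥ ℓ) j) ≤ WithZero.exp (-(m - 1)) := by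
    rw [hgu']; exact hgu'B'
  -- the two readouts
  have hHr : H.toAddSubgroup = (W ⊓ L.comap θ).comap ι := by
    ext q
    rw [Submodule.mem_toAddSubgroup, hH, mem_comap_readout_iff, hW, hL, hB, hι,
      forall_mulVec_mem_latticeOfGL_map_mul_iff_readout A u₀ ε θ m hsplit hθint hθA haway hint ρ hρ 𝔮 π₁ hπ₁ hπ₁v a g hg hgloc q, hgui]
  have hHr' : H'.toAddSubgroup = (W ⊓ L'.comap θ).comap ι := by
    ext q
    rw [Submodule.mem_toAddSubgroup, hH', mem_comap_readout_iff, hW, hL', hB, hι,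
      forall_mulVec_mem_latticeOfGL_map_mul_iff_readout A u₀ ε θ m hsplit hθint hθA haway hint ρ hρ 𝔮 π₁ hπ₁ hπ₁v a g' hg' hgloc' q, hgu'i]
  -- sandwiches and density
  have hinv : ∀ (x : GL (Fin 2) (u₀.adicCompletion F)) (e : Fin 2 → u₀.adicCompletion F),
      ((x : GL (Fin 2) (u₀.adicCompletion F)) : Matrix (Fin 2) (Fin 2) (u₀.adicCompletion F)) *ᵥ
        ((((x⁻¹ : GL (Fin 2) (u₀.adicCompletion F)) : Matrix (Fin 2) (Fin 2) (u₀.adicCompletion F))) *ᵥ e) = e := fun x e => by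
    rw [Matrix.mulVec_mulVec, ← Units.val_mul, mul_inv_cancel, Units.val_one, Matrix.one_mulVec]
  have hBL : B ≤ L := fun ℓ hℓ => (hL ℓ).2 ((hB _).2 (hguB ℓ ((hB ℓ).1 hℓ)))
  have hBL' : B ≤ L' := fun ℓ hℓ => (hL' ℓ).2 ((hB _).2 (hgu'B ℓ ((hB ℓ).1 hℓ)))
  have hdense_of : ∀ {L₀ : AddSubgroup (Fin 2 → u₀.adicCompletion F)}, (∀ e ∈ L₀, ∀ j, Valued.v (e j) ≤ WithZero.exp (-(m - 1))) →
      ∀ e ∈ L₀, ∃ v : N → ℚ, ι v ∈ W ∧ θ (ι v) - e ∈ B := by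
    intro L₀ hL₀ e he
    obtain ⟨q, hqA, hq⟩ := exists_rat_readout_sub_mem A u₀ ε θ m hsplit hθint hθA hθsurj hε hε₁ hp hpu a 1 e
      (fun j => by rw [Nat.cast_one]; exact hL₀ e he j)
    exact ⟨q, (hW _).2 (by rw [hι]; exact hqA), (hB _).2 (by rw [hι]; exact hq)⟩
  have hLB : ∀ e ∈ L, ∀ j, Valued.v (e j) ≤ WithZero.exp (-(m - 1)) := fun e he => by
    rw [← hinv gu e]; exact hguB' _ ((hB _).1 ((hL e).1 he))
  have hLB' : ∀ e ∈ L', ∀ j, Valued.v (e j) ≤ WithZero.exp (-(m - 1)) := fun e he => by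
    rw [← hinv gu' e]; exact hgu'B' _ ((hB _).1 ((hL' e).1 he))
  have hLL' : L = L' := by
    refine eq_of_comap_readout_eq ι θ W hBL hBL' (hdense_of hLB) (hdense_of hLB') ?_
    rw [← hHr, ← hHr', hHH']
  -- read off at `ℓ′ = g′_{u₀} ℓ`
  have key : ((gu' : GL (Fin 2) (u₀.adicCompletion F)) : Matrix (Fin 2) (Fin 2) (u₀.adicCompletion F)) *ᵥ ℓ ∈ L ↔
      ((gu' : GL (Fin 2) (u₀.adicCompletion F)) : Matrix (Fin 2) (Fin 2) (u₀.adicCompletion F)) *ᵥ ℓ ∈ L' := by rw [hLL']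
  rw [hL, hL', hB, hB, Matrix.mulVec_mulVec, Matrix.mulVec_mulVec, ← Units.val_mul, ← Units.val_mul, inv_mul_cancel, Units.val_one,
    Matrix.one_mulVec] at key
  exact key.symm

end Literature.NumberTheory.Adeles.Readout

end
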